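import Literature.Computability.Complexity.BPPErrorReductionStrong
import HarnessLib

/-!
# Estimating a probability by sampling: two-sided deviation bounds in counting form

Literature / complexity toolkit (finite probability over coin strings). `BPPErrorReductionStrong.lean`
reads a coin string of length `t·P` as `t` independent blocks of `P` bits (`BPPAmp.block`,
`BPPAmp.nbad t P E y` = the number of blocks of `y` lying in the event `E`, `BPPAmp.blocksEquiv`)
and proves, by Hoeffding's inequality in counting form
(`Literature.Probability.Moments.hoeffding_count_pi`), the ONE instance needed by the majority vote
(`card_half_bad_le`: blocks bad with probability `≤ 1/4` are at least half bad with probability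
`≤ e^{-t/32}`). This file proves the general two-sided SAMPLING ESTIMATE in the same vocabulary: the
empirical frequency `nbad/t` of an event of probability `e = Pr_{{0,1}^P}[E]` among `t ≥ 1`
independent uniform blocks deviates from `e` by `θ ≥ 0` or more, on either side, with probability
at most `exp(-θ² t / 2)`:

* `BPPAmp.card_freq_ge_le`, `BPPAmp.card_freq_le_le` — the counts over the product space
  `Fin t → (Fin P → Bool)` (Hoeffding with the centred indicators `𝟙_E − e`, resp. `e − 𝟙_E`);
* **`BPPAmp.uniformProb_nbad_ge_le`**, **`BPPAmp.uniformProb_nbad_le_le`** — the same over coin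
  strings: `Pr_y[nbad ≥ t (e + θ)] ≤ exp(-θ² t/2)` and `Pr_y[nbad ≤ t (e − θ)] ≤ exp(-θ² t/2)`.

This is the estimate behind every "estimate the probability by random sampling" step of uniform
reductions — e.g. Impagliazzo–Wigderson 1998, Lemma 14 ("we can estimate its distinguishing
probability by sampling") and Lemma 18 ("by random sampling … estimate the probability that
`C(x) = h(x)`") — in the counting form consumed by the tree's `uniformProb`/`RandAlg.pr`.
Everything is proved; no definitions.

## References

* W. Hoeffding, *Probability inequalities for sums of bounded random variables*, JASA 58 (1963)
  13–30, Thm. 2 [Hoeffding1963].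
* R. Impagliazzo, A. Wigderson, *Randomness vs time: derandomization under a uniform assumption*,
  JCSS 63 (2001), Lemmas 14 and 18 (the consumers) [ImpagliazzoWigderson2001].
* S. Arora, B. Barak, *Computational Complexity: A Modern Approach*, CUP 2009, Thm. 7.10 (proof:
  "the Chernoff bound") and §A.2 [AroraBarakCC2009].
-/

noncomputable section

namespace Literature.Computability.Complexity

namespace BPPAmp

open Finset Real Literature.Probability.Moments

open scoped Classical

variable (t P : ℕ)

/-- The number of bit vectors of length `P` is `2^P`, as a real number. [folklore] -/
private theorem card_fun_bool_real : (Fintype.card (Fin P → Bool) : ℝ) = 2 ^ P := by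
  rw [Fintype.card_fun, Fintype.card_bool, Fintype.card_fin]; push_cast; rfl

/-- The probability of `E` among blocks, as a count over bit vectors divided by `2^P`. [folklore] -/
private theorem uniformProb_eq_card_div (E : Set (List Bool)) :
    uniformProb P E = ((univ.filter fun a : Fin P → Bool => List.ofFn a ∈ E).card : ℝ) / 2 ^ P := by
  rw [uniformProb_eq_cnt_div, cnt_eq_card_ofFn]

/-- **Upper deviation, product-space count**: among the `t`-tuples of blocks, those with at least
`t (e + θ)` coordinates in `E` (`e = Pr[E]`, `θ ≥ 0`, `t ≥ 1`) number at most
`exp(-θ² t / 2) · 2^{tP}` (Hoeffding with `f_j = 𝟙_E − e`, `|f_j| ≤ 1`, threshold `tθ`).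
[cite: Hoeffding1963, Thm. 2] -/
theorem card_freq_ge_le (E : Set (List Bool)) (ht : 0 < t) {θ : ℝ} (hθ : 0 ≤ θ) :
    ((univ.filter fun ω : Fin t → Fin P → Bool =>
        (t : ℝ) * (uniformProb P E + θ) ≤
          ((univ.filter fun j : Fin t => List.ofFn (ω j) ∈ E).card : ℝ)).card : ℝ) ≤
      Real.exp (-(θ ^ 2 * t / 2)) * 2 ^ (t * P) := by
  set e : ℝ := uniformProb P E with he_def
  have h2P : (0 : ℝ) < 2 ^ P := by positivity
  have he0 : 0 ≤ e := uniformProb_nonneg _ _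
  have he1 : e ≤ 1 := uniformProb_le_one _ _
  -- the centred indicators
  let f : Fin t → (Fin P → Bool) → ℝ := fun _ a => (if List.ofFn a ∈ E then 1 else 0) - e
  have hf0 : ∀ j, ∑ a, f j a = 0 := by
    intro j
    simp only [f, sum_sub_distrib, sum_boole, sum_const, card_univ, nsmul_eq_mul, card_fun_bool_real]
    rw [he_def, uniformProb_eq_card_div, mul_div_cancel₀ _ h2P.ne']
    ring
  have hfc : ∀ j a, |f j a| ≤ (fun _ => (1 : ℝ)) j := by
    intro j a
    simp only [f]
    split_ifs <;> rw [abs_le] <;> constructor <;> linarith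
  have hS : 0 < ∑ j : Fin t, (fun _ => (1 : ℝ)) j ^ 2 := by
    simp only [one_pow, sum_const, card_univ, Fintype.card_fin, nsmul_eq_mul, mul_one]
    exact_mod_cast ht
  have hH := hoeffding_count_pi f (fun _ => (1 : ℝ)) hf0 hfc (t := t * θ) (by positivity) hS
  have hsum1 : ∑ j : Fin t, (fun _ => (1 : ℝ)) j ^ 2 = t := by
    simp only [one_pow, sum_const, card_univ, Fintype.card_fin, nsmul_eq_mul, mul_one]
  have hprod : ∏ _j : Fin t, (Fintype.card (Fin P → Bool) : ℝ) = 2 ^ (t * P) := by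
    rw [prod_const, card_univ, Fintype.card_fin, card_fun_bool_real, ← pow_mul, mul_comm]
  have ht' : (0 : ℝ) < t := by exact_mod_cast ht
  have hexp : -((t * θ : ℝ) ^ 2 / (2 * t)) = -(θ ^ 2 * t / 2) := by
    field_simp
  rw [hsum1, hprod, hexp] at hH
  refine le_trans ?_ hH
  have hsub : (univ.filter fun ω : Fin t → Fin P → Bool =>
      (t : ℝ) * (uniformProb P E + θ) ≤ ((univ.filter fun j : Fin t => List.ofFn (ω j) ∈ E).card : ℝ)) ⊆
      univ.filter fun ω : Fin t → Fin P → Bool => (t * θ : ℝ) ≤ ∑ j, f j (ω j) := by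
    intro ω hω
    simp only [mem_filter, mem_univ, true_and] at hω ⊢
    have hsumf : ∑ j, f j (ω j) =
        ((univ.filter fun j : Fin t => List.ofFn (ω j) ∈ E).card : ℝ) - t * e := by
      simp only [f, sum_sub_distrib, sum_boole, sum_const, card_univ, Fintype.card_fin, nsmul_eq_mul]
    rw [hsumf]
    rw [← he_def] at hω
    nlinarith
  exact_mod_cast card_le_card hsub

/-- **Lower deviation, product-space count**: among the `t`-tuples of blocks, those with at most
`t (e − θ)` coordinates in `E` number at most `exp(-θ² t / 2) · 2^{tP}` (Hoeffding with
`f_j = e − 𝟙_E`). [cite: Hoeffding1963, Thm. 2] -/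
theorem card_freq_le_le (E : Set (List Bool)) (ht : 0 < t) {θ : ℝ} (hθ : 0 ≤ θ) :
    ((univ.filter fun ω : Fin t → Fin P → Bool =>
        ((univ.filter fun j : Fin t => List.ofFn (ω j) ∈ E).card : ℝ) ≤
          (t : ℝ) * (uniformProb P E - θ)).card : ℝ) ≤
      Real.exp (-(θ ^ 2 * t / 2)) * 2 ^ (t * P) := by
  set e : ℝ := uniformProb P E with he_def
  have h2P : (0 : ℝ) < 2 ^ P := by positivity
  have he0 : 0 ≤ e := uniformProb_nonneg _ _
  have he1 : e ≤ 1 := uniformProb_le_one _ _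
  let f : Fin t → (Fin P → Bool) → ℝ := fun _ a => e - (if List.ofFn a ∈ E then 1 else 0)
  have hf0 : ∀ j, ∑ a, f j a = 0 := by
    intro j
    simp only [f, sum_sub_distrib, sum_boole, sum_const, card_univ, nsmul_eq_mul, card_fun_bool_real]
    rw [he_def, uniformProb_eq_card_div, mul_div_cancel₀ _ h2P.ne']
    ring
  have hfc : ∀ j a, |f j a| ≤ (fun _ => (1 : ℝ)) j := by
    intro j a
    simp only [f]
    split_ifs <;> rw [abs_le] <;> constructor <;> linarith
  have hS : 0 < ∑ j : Fin t, (fun _ => (1 : ℝ)) j ^ 2 := by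
    simp only [one_pow, sum_const, card_univ, Fintype.card_fin, nsmul_eq_mul, mul_one]
    exact_mod_cast ht
  have hH := hoeffding_count_pi f (fun _ => (1 : ℝ)) hf0 hfc (t := t * θ) (by positivity) hS
  have hsum1 : ∑ j : Fin t, (fun _ => (1 : ℝ)) j ^ 2 = t := by
    simp only [one_pow, sum_const, card_univ, Fintype.card_fin, nsmul_eq_mul, mul_one]
  have hprod : ∏ _j : Fin t, (Fintype.card (Fin P → Bool) : ℝ) = 2 ^ (t * P) := by
    rw [prod_const, card_univ, Fintype.card_fin, card_fun_bool_real, ← pow_mul, mul_comm]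
  have ht' : (0 : ℝ) < t := by exact_mod_cast ht
  have hexp : -((t * θ : ℝ) ^ 2 / (2 * t)) = -(θ ^ 2 * t / 2) := by
    field_simp
  rw [hsum1, hprod, hexp] at hH
  refine le_trans ?_ hH
  have hsub : (univ.filter fun ω : Fin t → Fin P → Bool =>
      ((univ.filter fun j : Fin t => List.ofFn (ω j) ∈ E).card : ℝ) ≤ (t : ℝ) * (uniformProb P E - θ)) ⊆
      univ.filter fun ω : Fin t → Fin P → Bool => (t * θ : ℝ) ≤ ∑ j, f j (ω j) := by
    intro ω hω
    simp only [mem_filter, mem_univ, true_and] at hω ⊢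
    have hsumf : ∑ j, f j (ω j) =
        t * e - ((univ.filter fun j : Fin t => List.ofFn (ω j) ∈ E).card : ℝ) := by
      simp only [f, sum_sub_distrib, sum_boole, sum_const, card_univ, Fintype.card_fin, nsmul_eq_mul]
    rw [hsumf]
    rw [← he_def] at hω
    nlinarith
  exact_mod_cast card_le_card hsub

variable {t P}

/-- Transfer of an event about the number of blocks in `E` from coin strings of length `t·P` to the
product space `Fin t → (Fin P → Bool)` (`blocksEquiv`, `nbad_eq_card`). [folklore] -/
theorem cnt_setOf_nbad_eq_card (E : Set (List Bool)) (Q : ℕ → Prop) :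
    cnt (t * P) {y | Q (nbad t P E y)} =
      (univ.filter fun ω : Fin t → Fin P → Bool =>
        Q (univ.filter fun j : Fin t => List.ofFn (ω j) ∈ E).card).card := by
  unfold cnt
  refine card_equiv (blocksEquiv t P) fun v => ?_
  simp only [mem_filter, mem_univ, true_and, Set.mem_setOf_eq]
  rw [nbad_eq_card]

/-- **Sampling estimate, upper deviation**: for an event `E` of probability `e` among blocks of
`P` bits, a uniform string of `t ≥ 1` blocks has at least `t (e + θ)` blocks in `E` with probability
at most `exp(-θ² t / 2)` (`θ ≥ 0`). [cite: Hoeffding1963, Thm. 2]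
[cite: ImpagliazzoWigderson2001, Lemma 14 (proof: "estimate … by sampling")] -/
theorem uniformProb_nbad_ge_le (E : Set (List Bool)) (ht : 0 < t) {θ : ℝ} (hθ : 0 ≤ θ) :
    uniformProb (t * P) {y | (t : ℝ) * (uniformProb P E + θ) ≤ nbad t P E y} ≤
      Real.exp (-(θ ^ 2 * t / 2)) := by
  have h2 : (0 : ℝ) < 2 ^ (t * P) := by positivity
  rw [uniformProb_eq_cnt_div, div_le_iff₀ h2]
  have htrans := cnt_setOf_nbad_eq_card (t := t) (P := P) E
    (fun N => (t : ℝ) * (uniformProb P E + θ) ≤ N)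
  calc (cnt (t * P) {y | (t : ℝ) * (uniformProb P E + θ) ≤ nbad t P E y} : ℝ)
      = ((univ.filter fun ω : Fin t → Fin P → Bool =>
          (t : ℝ) * (uniformProb P E + θ) ≤
            ((univ.filter fun j : Fin t => List.ofFn (ω j) ∈ E).card : ℝ)).card : ℝ) := by
        rw [htrans]
    _ ≤ Real.exp (-(θ ^ 2 * t / 2)) * 2 ^ (t * P) := card_freq_ge_le t P E ht hθ

/-- **Sampling estimate, lower deviation**: a uniform string of `t ≥ 1` blocks has at most
`t (e − θ)` blocks in `E` with probability at most `exp(-θ² t / 2)` (`θ ≥ 0`).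
[cite: Hoeffding1963, Thm. 2] [cite: ImpagliazzoWigderson2001, Lemma 14 (proof: "estimate … by sampling")] -/
theorem uniformProb_nbad_le_le (E : Set (List Bool)) (ht : 0 < t) {θ : ℝ} (hθ : 0 ≤ θ) :
    uniformProb (t * P) {y | (nbad t P E y : ℝ) ≤ (t : ℝ) * (uniformProb P E - θ)} ≤
      Real.exp (-(θ ^ 2 * t / 2)) := by
  have h2 : (0 : ℝ) < 2 ^ (t * P) := by positivity
  rw [uniformProb_eq_cnt_div, div_le_iff₀ h2]
  have htrans := cnt_setOf_nbad_eq_card (t := t) (P := P) E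
    (fun N => (N : ℝ) ≤ (t : ℝ) * (uniformProb P E - θ))
  calc (cnt (t * P) {y | (nbad t P E y : ℝ) ≤ (t : ℝ) * (uniformProb P E - θ)} : ℝ)
      = ((univ.filter fun ω : Fin t → Fin P → Bool =>
          ((univ.filter fun j : Fin t => List.ofFn (ω j) ∈ E).card : ℝ) ≤
            (t : ℝ) * (uniformProb P E - θ)).card : ℝ) := by
        rw [htrans]
    _ ≤ Real.exp (-(θ ^ 2 * t / 2)) * 2 ^ (t * P) := card_freq_le_le t P E ht hθ

end BPPAmp

end Literature.Computability.Complexity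

end
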